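/-
Copyright (c) 2026 the pub-hodgecm-mathlib formalisation cell (harness21).  Prover seat hodgecm-mathlib-K2Liu-p23 (g2), Track B «K2-LIT»,
#184♮ = hLiu418 = `stmt-HodgeConjecture-24832`; #42F′ FACE-G organ F4 (G-gen), road (E) (RULINGS M-158r/s/u), THE BRIDGE «(A) invariant-theory rings →
(F) Fock ring», part 3: TRANSPORT OF THE BLOCK FIRST FUNDAMENTAL THEOREM along a re-indexing of the coordinates, and the (E-a0) dictionary
(F4 lead K2Liu-p27 (g2) 2026-09-04T23:15:26Z (B); LEAD F0P6-plan (g14) BATCH #128).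
KERNEL: theorems only.
-/
import Summits.HodgeConjecture.HodgeConjecture.Theorems.K2LiuUnitaryPolySubstDefs   -- ★ (E-a0): `substFun`, `polySubst`, `contraction`, `IsUnitaryInvariant`
import Mathlib.LinearAlgebra.UnitaryGroup
import Mathlib.RingTheory.Adjoin.Basic
import HarnessLib

/-!
# Crux `HLiu418`, FACE-G organ F4, road (E): THE BRIDGE, part 3 — the block first fundamental theorem is invariant under re-indexing the coordinates
# (`R ≃ R′`), and at `R = Fin p`, `P = Q = Fin 2` its hypothesis IS (E-a0)'s `IsUnitaryInvariant`

Cell `hodgecm-mathlib`, crux item hLiu418 = `stmt-HodgeConjecture-24832`, route of record `HCCMUnconditional`; squad K2 ∕ K2Liu, road `K2_Liu`,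
socket #42F′, FACE-G organ F4 (G-gen) under RULING M-158r «(E) COMPACT SEE-SAW + FFT + PBW INDUCTION + `K_H`-AVERAGING» (K2E5-r02 (g6)); F4 lead
K2Liu-p27 (g2), desks K2Liu-p10 (g6) ∕ K2E5-r02 (g6).  THEOREMS ONLY (no `def`, no `instance`, no `notation`, no named-fact hypothesis, no `sorry`);
lane `--supports stmt-HodgeConjecture-24832 --as helper` (count-neutral helper).

WHY.  The bridge (★ `K2LiuFockPolySubstBridge`, `K2LiuFockInvariantsOfBlocks`) proves the letter (FFT) of ★ (E-f) at the Fock instance from two BLOCK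
first fundamental theorems `hR`, `hS`, stated for ABSTRACT finite coordinate types `R`, `S` (at the global instance `R = PosIdx …`, `S = NegIdx …` are
subtypes) in the currency «`∀ f : MvPolynomial ((P × R) ⊕ (Q × R)) ℂ`, invariant under `x ↦ x·c`, `y ↦ y·c̄` for all `c ∈ U(R)` ⇒
`f ∈ Algebra.adjoin ℂ {Σ_r x_{(p,r)} y_{(q,r)}}`».  The first fundamental theorem itself [cite: Weyl1939, Thm. 2.6.A] [cite: GoodmanWallachGTM255, Thm. 5.2.1]
is ★ in the tree for coordinates `Fin p` (`Literature…ClassicalInvariants.GeneralLinearPolynomialFFTGeneral`, read in (E-a0) currency by K2E1-p10 (g4)'s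
adapter `K2LiuUnitaryFFTContractions` + ★ (E-a1) `K2LiuUnitaryZariskiDensity`).  This file supplies the two purely formal steps in between:

* § 1 `submatrix_mem_unitaryGroup` (`c′.submatrix e e ∈ U(R)` for `c′ ∈ U(R′)`, `e : R ≃ R′`), `rename_comp_aeval_blockSubst`
  (re-indexing intertwines the block substitutions), `rename_symm_blockContraction` (and the contractions);
  **`blockFFT_of_equiv`** — THE BLOCK FFT TRANSPORTS ALONG `e : R ≃ R′`: if it holds for coordinates `R′` it holds for `R` (same labels `P`, `Q`).
* § 2 `adjoin_blockContraction_swap` — the generator family indexed by `(ij.2, ij.1)` generates the same subalgebra (the `S`-block of the bridge indexes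
  its contractions that way).
* § 3 AT `R = Fin p`, `P = Q = Fin 2`: **`polySubst_toUnits_eq_aeval`** — (E-a0)'s `polySubst (Unitary.toUnits u)` IS the bridge's block substitution
  `aeval σ_u` (`↑(toUnits u)⁻¹ = star ↑u`); **`forall_aeval_blockSubst_iff_isUnitaryInvariant`** — the bridge's invariance hypothesis ⟺ (E-a0)
  `IsUnitaryInvariant f`; `range_blockContraction_eq` — the bridge's generator set = `Set.range fun ij => contraction ij.1 ij.2`.
  Hence **`blockFFT_of_unitaryFFT_fin`**: from a `Fin p`-indexed FFT in (E-a0) currency (`∀ f, IsUnitaryInvariant f → f ∈ Algebra.adjoin ℂ (range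
  contraction)`, the adapter's head) to the bridge's `hR` for EVERY finite coordinate type `R` with `Fintype.card R = p`.

References: [Weyl1939] Ch. II §6 Thm. 2.6.A; [GoodmanWallachGTM255] §5.2.1 Thm. 5.2.1; [Howe1989Remarks] §2.
HONEST LABEL.  Count-neutral helper; it retires nothing by itself: `HC_CM` is proved only modulo the 7 printed citations (2 remaining named inputs:
hLiu418 = `stmt-HodgeConjecture-24832`, h413 = `stmt-HodgeConjecture-24833`) until rung 0 closes.

## References
* [Weyl1939] H. Weyl, *The Classical Groups*, Princeton (1939), Ch. II §6, Thm. 2.6.A.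
* [GoodmanWallachGTM255] R. Goodman, N. R. Wallach, *Symmetry, Representations, and Invariants*, GTM 255 (2009), Thm. 5.2.1.
* [Howe1989Remarks] R. Howe, *Remarks on classical invariant theory*, Trans. AMS 313 (1989), §2.
-/

set_option autoImplicit false
set_option linter.dupNamespace false -- the mandated namespace repeats `HodgeConjecture.HodgeConjecture`

open scoped BigOperators
open MvPolynomial Matrix
open Summit.HodgeConjecture.HodgeConjecture.Cruxes.HLiu418.K2LiuUnitaryPolySubstDefs

namespace Summit.HodgeConjecture.HodgeConjecture.Cruxes.HLiu418.K2LiuFockBlockFFTTransport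

variable {P Q R R' : Type*} [Fintype R] [DecidableEq R] [Fintype R'] [DecidableEq R']

/-! ## § 1 Transport of the block first fundamental theorem along `e : R ≃ R′` -/

/-- **re-indexing a unitary matrix is unitary**: `c′.submatrix e e ∈ U(R)` for `c′ ∈ U(R′)` and `e : R ≃ R′`. [folklore] -/
theorem submatrix_mem_unitaryGroup (e : R ≃ R') (c' : Matrix.unitaryGroup R' ℂ) :
    (c' : Matrix R' R' ℂ).submatrix e e ∈ Matrix.unitaryGroup R ℂ := by
  rw [Matrix.mem_unitaryGroup_iff', Matrix.star_eq_conjTranspose, Matrix.conjTranspose_submatrix, Matrix.submatrix_mul_equiv,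
    ← Matrix.star_eq_conjTranspose, Matrix.mem_unitaryGroup_iff'.mp c'.2, Matrix.submatrix_one_equiv]

/-- **re-indexing intertwines the block substitutions**: with `c := c′.submatrix e e`,
`rename ε ∘ aeval σ_c = aeval σ_{c′} ∘ rename ε` for `ε = id × e` on both kinds of variables. [folklore] -/
theorem rename_comp_aeval_blockSubst (e : R ≃ R') (c' : Matrix.unitaryGroup R' ℂ) :
    (rename (Equiv.sumCongr (Equiv.prodCongr (Equiv.refl P) e) (Equiv.prodCongr (Equiv.refl Q) e)) :
        MvPolynomial ((P × R) ⊕ (Q × R)) ℂ →ₐ[ℂ] MvPolynomial ((P × R') ⊕ (Q × R')) ℂ).comp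
      (aeval (Sum.elim
          (fun pr : P × R => ∑ b : R, X (Sum.inl (pr.1, b)) *
            C (((⟨(c' : Matrix R' R' ℂ).submatrix e e, submatrix_mem_unitaryGroup e c'⟩ : Matrix.unitaryGroup R ℂ) : Matrix R R ℂ) b pr.2))
          (fun qr : Q × R => ∑ b : R, X (Sum.inr (qr.1, b)) *
            C ((star ((⟨(c' : Matrix R' R' ℂ).submatrix e e, submatrix_mem_unitaryGroup e c'⟩ : Matrix.unitaryGroup R ℂ) : Matrix R R ℂ)) qr.2 b)) :
          (P × R) ⊕ (Q × R) → MvPolynomial ((P × R) ⊕ (Q × R)) ℂ)) =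
      (aeval (Sum.elim
          (fun pr : P × R' => ∑ b : R', X (Sum.inl (pr.1, b)) * C ((c' : Matrix R' R' ℂ) b pr.2))
          (fun qr : Q × R' => ∑ b : R', X (Sum.inr (qr.1, b)) * C ((star (c' : Matrix R' R' ℂ)) qr.2 b)) :
          (P × R') ⊕ (Q × R') → MvPolynomial ((P × R') ⊕ (Q × R')) ℂ)).comp
        (rename (Equiv.sumCongr (Equiv.prodCongr (Equiv.refl P) e) (Equiv.prodCongr (Equiv.refl Q) e))) := by
  refine MvPolynomial.algHom_ext fun v => ?_
  rcases v with ⟨p, r⟩ | ⟨q, r⟩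
  · simp only [AlgHom.comp_apply, aeval_X, rename_X, Sum.elim_inl, Equiv.sumCongr_apply, Sum.map_inl, Equiv.prodCongr_apply, Prod.map_apply,
      Equiv.coe_refl, id_eq, map_sum, map_mul, rename_X, algHom_C, algebraMap_eq, Matrix.submatrix_apply]
    exact Equiv.sum_comp e (fun b : R' => X (Sum.inl (p, b)) * C ((c' : Matrix R' R' ℂ) b (e r)))
  · simp only [AlgHom.comp_apply, aeval_X, rename_X, Sum.elim_inr, Equiv.sumCongr_apply, Sum.map_inr, Equiv.prodCongr_apply, Prod.map_apply,
      Equiv.coe_refl, id_eq, map_sum, map_mul, rename_X, algHom_C, algebraMap_eq, Matrix.star_eq_conjTranspose, Matrix.conjTranspose_submatrix,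
      Matrix.submatrix_apply]
    exact Equiv.sum_comp e (fun b : R' => X (Sum.inr (q, b)) * C ((c' : Matrix R' R' ℂ)ᴴ (e r) b))

omit [DecidableEq R] [DecidableEq R'] in
/-- **re-indexing back sends the `R′`-contractions to the `R`-contractions**: `rename ε⁻¹ (Σ_{r′} x_{(p,r′)} y_{(q,r′)}) = Σ_r x_{(p,r)} y_{(q,r)}`. [folklore] -/
theorem rename_symm_blockContraction (e : R ≃ R') (ij : P × Q) :
    rename (Equiv.sumCongr (Equiv.prodCongr (Equiv.refl P) e) (Equiv.prodCongr (Equiv.refl Q) e)).symm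
        (∑ r : R', X (Sum.inl (ij.1, r)) * X (Sum.inr (ij.2, r)) : MvPolynomial ((P × R') ⊕ (Q × R')) ℂ) =
      (∑ r : R, X (Sum.inl (ij.1, r)) * X (Sum.inr (ij.2, r)) : MvPolynomial ((P × R) ⊕ (Q × R)) ℂ) := by
  simp only [map_sum, map_mul, rename_X, Equiv.sumCongr_symm, Equiv.sumCongr_apply, Sum.map_inl, Sum.map_inr, Equiv.prodCongr_symm,
    Equiv.prodCongr_apply, Prod.map_apply, Equiv.refl_symm, Equiv.coe_refl, id_eq]
  exact (Equiv.sum_comp e.symm (fun r : R => (X (Sum.inl (ij.1, r)) * X (Sum.inr (ij.2, r)) : MvPolynomial ((P × R) ⊕ (Q × R)) ℂ)))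

/-- **THE BLOCK FIRST FUNDAMENTAL THEOREM TRANSPORTS ALONG A RE-INDEXING `e : R ≃ R′` OF THE COORDINATES**: if every `U(R′)`-invariant polynomial in
`x_{(p,r′)}, y_{(q,r′)}` lies in the subalgebra generated by the contractions `Σ_{r′} x_{(p,r′)} y_{(q,r′)}`, then the same holds with `R` in place of
`R′`.  (Re-index `f` to `f′ = rename ε f`; `U(R′)`-invariance of `f′` from `U(R)`-invariance of `f` through `c = c′.submatrix e e`; re-index the
conclusion back.) [cite: Weyl1939, Thm. 2.6.A] [cite: GoodmanWallachGTM255, Thm. 5.2.1] -/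
theorem blockFFT_of_equiv (e : R ≃ R')
    (h' : ∀ f' : MvPolynomial ((P × R') ⊕ (Q × R')) ℂ,
      (∀ c' : Matrix.unitaryGroup R' ℂ, aeval (Sum.elim
          (fun pr : P × R' => ∑ b : R', X (Sum.inl (pr.1, b)) * C ((c' : Matrix R' R' ℂ) b pr.2))
          (fun qr : Q × R' => ∑ b : R', X (Sum.inr (qr.1, b)) * C ((star (c' : Matrix R' R' ℂ)) qr.2 b)) :
          (P × R') ⊕ (Q × R') → MvPolynomial ((P × R') ⊕ (Q × R')) ℂ) f' = f') →
        f' ∈ Algebra.adjoin ℂ (Set.range fun ij : P × Q =>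
          (∑ r : R', X (Sum.inl (ij.1, r)) * X (Sum.inr (ij.2, r)) : MvPolynomial ((P × R') ⊕ (Q × R')) ℂ)))
    (f : MvPolynomial ((P × R) ⊕ (Q × R)) ℂ)
    (hf : ∀ c : Matrix.unitaryGroup R ℂ, aeval (Sum.elim
        (fun pr : P × R => ∑ b : R, X (Sum.inl (pr.1, b)) * C ((c : Matrix R R ℂ) b pr.2))
        (fun qr : Q × R => ∑ b : R, X (Sum.inr (qr.1, b)) * C ((star (c : Matrix R R ℂ)) qr.2 b)) :
        (P × R) ⊕ (Q × R) → MvPolynomial ((P × R) ⊕ (Q × R)) ℂ) f = f) :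
    f ∈ Algebra.adjoin ℂ (Set.range fun ij : P × Q =>
      (∑ r : R, X (Sum.inl (ij.1, r)) * X (Sum.inr (ij.2, r)) : MvPolynomial ((P × R) ⊕ (Q × R)) ℂ)) := by
  set ε := Equiv.sumCongr (Equiv.prodCongr (Equiv.refl P) e) (Equiv.prodCongr (Equiv.refl Q) e) with hε
  -- the re-indexed polynomial is `U(R′)`-invariant
  have hf' : ∀ c' : Matrix.unitaryGroup R' ℂ, aeval (Sum.elim
      (fun pr : P × R' => ∑ b : R', X (Sum.inl (pr.1, b)) * C ((c' : Matrix R' R' ℂ) b pr.2))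
      (fun qr : Q × R' => ∑ b : R', X (Sum.inr (qr.1, b)) * C ((star (c' : Matrix R' R' ℂ)) qr.2 b)) :
      (P × R') ⊕ (Q × R') → MvPolynomial ((P × R') ⊕ (Q × R')) ℂ) (rename ε f) = rename ε f := by
    intro c'
    have key := congrArg (fun φ : MvPolynomial ((P × R) ⊕ (Q × R)) ℂ →ₐ[ℂ] MvPolynomial ((P × R') ⊕ (Q × R')) ℂ => φ f)
      (rename_comp_aeval_blockSubst (P := P) (Q := Q) e c')
    rw [AlgHom.comp_apply, AlgHom.comp_apply, ← hε,
      hf ⟨(c' : Matrix R' R' ℂ).submatrix e e, submatrix_mem_unitaryGroup e c'⟩] at key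
    exact key.symm
  have hmem := h' (rename ε f) hf'
  -- re-index back
  have hback : rename ε.symm (rename ε f) = f := by
    rw [rename_rename, Equiv.symm_comp_self, rename_id_apply]
  have h2 : f ∈ (Algebra.adjoin ℂ (Set.range fun ij : P × Q =>
      (∑ r : R', X (Sum.inl (ij.1, r)) * X (Sum.inr (ij.2, r)) : MvPolynomial ((P × R') ⊕ (Q × R')) ℂ))).map
      (rename ε.symm : MvPolynomial ((P × R') ⊕ (Q × R')) ℂ →ₐ[ℂ] MvPolynomial ((P × R) ⊕ (Q × R)) ℂ) := by
    rw [← hback]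
    exact Subalgebra.mem_map.mpr ⟨rename ε f, hmem, rfl⟩
  rw [AlgHom.map_adjoin, ← Set.range_comp] at h2
  convert h2 using 3
  funext ij
  rw [Function.comp_apply, hε, rename_symm_blockContraction]

/-! ## § 2 Swapping the index order of the generator family -/

omit [DecidableEq R] in
/-- the contractions indexed by `(ij.2, ij.1)` over `Q × P` generate the same subalgebra as those indexed by `(ij.1, ij.2)` over `P × Q`. [folklore] -/
theorem adjoin_blockContraction_swap :
    Algebra.adjoin ℂ (Set.range fun ij : Q × P =>
      (∑ r : R, X (Sum.inl (ij.2, r)) * X (Sum.inr (ij.1, r)) : MvPolynomial ((P × R) ⊕ (Q × R)) ℂ)) =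
    Algebra.adjoin ℂ (Set.range fun ij : P × Q =>
      (∑ r : R, X (Sum.inl (ij.1, r)) * X (Sum.inr (ij.2, r)) : MvPolynomial ((P × R) ⊕ (Q × R)) ℂ)) := by
  congr 1
  ext x
  constructor
  · rintro ⟨ij, rfl⟩
    exact ⟨ij.swap, rfl⟩
  · rintro ⟨ij, rfl⟩
    exact ⟨ij.swap, rfl⟩

/-! ## § 3 At `R = Fin p`, `P = Q = Fin 2`: the dictionary with (E-a0) -/

/-- **(E-a0)'s `polySubst (toUnits u)` IS the bridge's block substitution `aeval σ_u`** (`u ∈ U(p)`): on `x_{(i,a)}` both give `Σ_b x_{(i,b)} u_{ba}`;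
on `y_{(j,a)}` (E-a0) gives `Σ_b y_{(j,b)} ((toUnits u)⁻¹)_{ab}` and `↑(toUnits u)⁻¹ = ↑u⁻¹ = star ↑u`. [cite: Howe1989Remarks, §2] -/
theorem polySubst_toUnits_eq_aeval {p : ℕ} (u : Matrix.unitaryGroup (Fin p) ℂ) (f : MvPolynomial ((Fin 2 × Fin p) ⊕ (Fin 2 × Fin p)) ℂ) :
    polySubst (Unitary.toUnits u) f = aeval (Sum.elim
        (fun pr : Fin 2 × Fin p => ∑ b : Fin p, X (Sum.inl (pr.1, b)) * C ((u : Matrix (Fin p) (Fin p) ℂ) b pr.2))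
        (fun qr : Fin 2 × Fin p => ∑ b : Fin p, X (Sum.inr (qr.1, b)) * C ((star (u : Matrix (Fin p) (Fin p) ℂ)) qr.2 b)) :
        (Fin 2 × Fin p) ⊕ (Fin 2 × Fin p) → MvPolynomial ((Fin 2 × Fin p) ⊕ (Fin 2 × Fin p)) ℂ) f := by
  have key : substFun (Unitary.toUnits u) = (Sum.elim
        (fun pr : Fin 2 × Fin p => ∑ b : Fin p, X (Sum.inl (pr.1, b)) * C ((u : Matrix (Fin p) (Fin p) ℂ) b pr.2))
        (fun qr : Fin 2 × Fin p => ∑ b : Fin p, X (Sum.inr (qr.1, b)) * C ((star (u : Matrix (Fin p) (Fin p) ℂ)) qr.2 b)) :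
        (Fin 2 × Fin p) ⊕ (Fin 2 × Fin p) → MvPolynomial ((Fin 2 × Fin p) ⊕ (Fin 2 × Fin p)) ℂ) := by
    funext v
    rcases v with ⟨i, a⟩ | ⟨j, a⟩
    · simp only [substFun_inl, Sum.elim_inl, Unitary.val_toUnits_apply]
    · simp only [substFun_inr, Sum.elim_inr, ← map_inv, Unitary.val_toUnits_apply, Matrix.UnitaryGroup.inv_val]
  rw [polySubst, key]

/-- **THE BRIDGE'S INVARIANCE HYPOTHESIS ⟺ (E-a0) `IsUnitaryInvariant`** (at `R = Fin p`, `P = Q = Fin 2`). [cite: Howe1989Remarks, §2] -/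
theorem forall_aeval_blockSubst_iff_isUnitaryInvariant {p : ℕ} (f : MvPolynomial ((Fin 2 × Fin p) ⊕ (Fin 2 × Fin p)) ℂ) :
    (∀ u : Matrix.unitaryGroup (Fin p) ℂ, aeval (Sum.elim
        (fun pr : Fin 2 × Fin p => ∑ b : Fin p, X (Sum.inl (pr.1, b)) * C ((u : Matrix (Fin p) (Fin p) ℂ) b pr.2))
        (fun qr : Fin 2 × Fin p => ∑ b : Fin p, X (Sum.inr (qr.1, b)) * C ((star (u : Matrix (Fin p) (Fin p) ℂ)) qr.2 b)) :
        (Fin 2 × Fin p) ⊕ (Fin 2 × Fin p) → MvPolynomial ((Fin 2 × Fin p) ⊕ (Fin 2 × Fin p)) ℂ) f = f) ↔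
      IsUnitaryInvariant f := by
  refine ⟨fun h u => ?_, fun h u => ?_⟩
  · rw [polySubst_toUnits_eq_aeval]
    exact h u
  · rw [← polySubst_toUnits_eq_aeval]
    exact h u

/-- **the bridge's generator set IS (E-a0)'s `Set.range fun ij => contraction ij.1 ij.2`** (at `R = Fin p`, `P = Q = Fin 2`). [folklore] -/
theorem range_blockContraction_eq {p : ℕ} :
    (Set.range fun ij : Fin 2 × Fin 2 =>
      (∑ r : Fin p, X (Sum.inl (ij.1, r)) * X (Sum.inr (ij.2, r)) : MvPolynomial ((Fin 2 × Fin p) ⊕ (Fin 2 × Fin p)) ℂ)) =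
    Set.range fun ij : Fin 2 × Fin 2 => (contraction ij.1 ij.2 : MvPolynomial ((Fin 2 × Fin p) ⊕ (Fin 2 × Fin p)) ℂ) := by
  simp only [contraction_def]

/-- **FROM A `Fin p`-INDEXED FIRST FUNDAMENTAL THEOREM IN (E-a0) CURRENCY TO THE BRIDGE'S BLOCK HYPOTHESIS FOR EVERY COORDINATE TYPE OF
CARDINALITY `p`**: if `∀ f, IsUnitaryInvariant f → f ∈ Algebra.adjoin ℂ (range contraction)` (the head of the (E-a) adapter over
★ `Literature…GeneralLinearPolynomialFFTGeneral` + ★ (E-a1)), then for every finite `R` with `Fintype.card R = p` the bridge's `hR` holds (labels `Fin 2`).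
[cite: Weyl1939, Thm. 2.6.A] [cite: GoodmanWallachGTM255, Thm. 5.2.1] -/
theorem blockFFT_of_unitaryFFT_fin {p : ℕ} (hR : Fintype.card R = p)
    (hFFT : ∀ f : MvPolynomial ((Fin 2 × Fin p) ⊕ (Fin 2 × Fin p)) ℂ, IsUnitaryInvariant f →
      f ∈ Algebra.adjoin ℂ (Set.range fun ij : Fin 2 × Fin 2 =>
        (contraction ij.1 ij.2 : MvPolynomial ((Fin 2 × Fin p) ⊕ (Fin 2 × Fin p)) ℂ)))
    (f : MvPolynomial ((Fin 2 × R) ⊕ (Fin 2 × R)) ℂ)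
    (hf : ∀ c : Matrix.unitaryGroup R ℂ, aeval (Sum.elim
        (fun pr : Fin 2 × R => ∑ b : R, X (Sum.inl (pr.1, b)) * C ((c : Matrix R R ℂ) b pr.2))
        (fun qr : Fin 2 × R => ∑ b : R, X (Sum.inr (qr.1, b)) * C ((star (c : Matrix R R ℂ)) qr.2 b)) :
        (Fin 2 × R) ⊕ (Fin 2 × R) → MvPolynomial ((Fin 2 × R) ⊕ (Fin 2 × R)) ℂ) f = f) :
    f ∈ Algebra.adjoin ℂ (Set.range fun ij : Fin 2 × Fin 2 =>
      (∑ r : R, X (Sum.inl (ij.1, r)) * X (Sum.inr (ij.2, r)) : MvPolynomial ((Fin 2 × R) ⊕ (Fin 2 × R)) ℂ)) := by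
  refine blockFFT_of_equiv (P := Fin 2) (Q := Fin 2) ((Fintype.equivFin R).trans (finCongr hR)) (fun f' hf' => ?_) f hf
  rw [range_blockContraction_eq]
  exact hFFT f' ((forall_aeval_blockSubst_iff_isUnitaryInvariant f').mp hf')

end Summit.HodgeConjecture.HodgeConjecture.Cruxes.HLiu418.K2LiuFockBlockFFTTransport
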